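import Summits.SmoothPoincare4.SmoothPoincare4.Theses.InformationMetricHadamard
import Literature.Geometry.Manifold.InverseFunctionTheorem
import Literature.Geometry.Lorentzian.Isometry
import Literature.AlgebraicTopology.FundamentalGroup.SphereSimplyConnected

/-!
# Stub `stub_collarPackage` of line `Sketch` (crux `InformationMetricHadamard.AhHadamardFilling`)

Collar bookkeeping for the crux's end collar `Φ : Σ × (0,1) → W⁵` (smooth, injective, immersive on
`Σ × (0,1)`, closure clause `cl Φ(Σ × (0,t)) ⊆ Φ(Σ × (0,1))`), with `K_t := (Φ(Σ × (0,t)))ᶜ`: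

* `nonempty_carrier`, `simplyConnectedSpace_carrier` — `Σ ≠ ∅` and `π₁ Σ = 1` for a homotopy
  4-sphere (Hatcher Prop. 1.14 transported along `Σ ≃ₕ S⁴`);
* `isOpen_image_collar`, `isOpen_image_far` — `Φ` is open on the collar (inverse function theorem,
  `4 + 1 = 5`), so the far parts `Φ(Σ × (0,t))` are open;
* `closure_image_far`, `frontier_far_compl` — `cl Φ(Σ × (0,t)) = Φ(Σ × (0,t])`, `∂K_t = Φ(Σ × {t})`;
* `continuousOn_invFunOn_collar`, `exists_retraction_far_compl` — `Φ⁻¹` is continuous on the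
  collar; `W` deformation retracts vertically onto `K_t`; `slice_contMDiff_injective_mfderiv` —
  `σ ↦ Φ(σ, t)` is a smooth immersion; `stub_collarPackage` — the registered bundle (skeleton r1).
Everything is proved (kind = proof); no definitions.
-/

noncomputable section

-- the prescribed namespace `Summit.<P>.<Sub>.…` duplicates `SmoothPoincare4` (P = Sub)
set_option linter.dupNamespace false

open scoped Manifold ContDiff Topology
open Set Function

namespace Summit.SmoothPoincare4.SmoothPoincare4.Cruxes.AhHadamardFilling.Sketch

open Literature.Topology.FourManifolds (HomotopySphere)

/-- Model space `ℝ⁴` of the cross-section. -/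
local notation "E4" => EuclideanSpace ℝ (Fin 4)
/-- Model space `ℝ⁵` of the filling. -/
local notation "E5" => EuclideanSpace ℝ (Fin 5)

variable (S : HomotopySphere 4) {W : Type} [TopologicalSpace W]
  [ChartedSpace E5 W] [IsManifold (𝓡 5) ∞ W] (Φ : S.carrier × ℝ → W)

/-- The carrier of a homotopy sphere is nonempty (it receives a map from `S⁴ ≠ ∅`). [folklore] -/
theorem nonempty_carrier : Nonempty S.carrier := by
  obtain ⟨e⟩ := S.nonempty_homotopyEquiv
  obtain ⟨v, hv⟩ := (NormedSpace.sphere_nonempty (E := E5) (x := (0 : E5)) (r := 1)).2 zero_le_one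
  exact ⟨e.invFun ⟨v, hv⟩⟩

/-- The carrier of a homotopy 4-sphere is simply connected (Hatcher Prop. 1.14 for `S⁴`, tree
theorem `simplyConnectedSpace_euclideanSphere`, transported along the homotopy equivalence).
[cite: HatcherAT2002, Prop. 1.14] -/
theorem simplyConnectedSpace_carrier : SimplyConnectedSpace S.carrier := by
  obtain ⟨e⟩ := S.nonempty_homotopyEquiv
  haveI := Literature.AlgebraicTopology.FundamentalGroup.simplyConnectedSpace_euclideanSphere 4
    (by norm_num)
  exact e.simplyConnectedSpace

/-- **The collar map is open on the collar**: an injective-differential smooth map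
`Φ : Σ × (0,1) → W⁵` is a local diffeomorphism at each point of `Σ × (0,1)` (inverse function
theorem, equal dimensions `4 + 1 = 5`), hence maps open subsets of `Σ × (0,1)` to open sets.
[folklore] -/
theorem isOpen_image_collar
    (hsm : ContMDiffOn ((𝓡 4).prod 𝓘(ℝ, ℝ)) (𝓡 5) ∞ Φ (univ ×ˢ Ioo (0 : ℝ) 1))
    (himm : ∀ p ∈ univ ×ˢ Ioo (0 : ℝ) 1,
      Function.Injective (mfderiv ((𝓡 4).prod 𝓘(ℝ, ℝ)) (𝓡 5) Φ p))
    {V : Set (S.carrier × ℝ)} (hV : IsOpen V) (hVΩ : V ⊆ univ ×ˢ Ioo (0 : ℝ) 1) :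
    IsOpen (Φ '' V) := by
  have hΩo : IsOpen (univ ×ˢ Ioo (0 : ℝ) 1 : Set (S.carrier × ℝ)) := isOpen_univ.prod isOpen_Ioo
  have hdim : Module.finrank ℝ (E4 × ℝ) = Module.finrank ℝ E5 := by
    rw [Module.finrank_prod, finrank_euclideanSpace_fin, finrank_euclideanSpace_fin,
      Module.finrank_self]
  have hloc : IsLocalDiffeomorphOn ((𝓡 4).prod 𝓘(ℝ, ℝ)) (𝓡 5) ∞ Φ (univ ×ˢ Ioo (0 : ℝ) 1) := by
    rintro ⟨x, hx⟩
    set L : (E4 × ℝ) ≃ₗ[ℝ] E5 :=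
      Literature.Geometry.Lorentzian.mfderivEquivOfInjective (I := 𝓡 5)
        (I' := (𝓡 4).prod 𝓘(ℝ, ℝ)) Φ x (himm x hx) hdim with hL
    refine Literature.Geometry.Manifold.isLocalDiffeomorphAt_of_mfderiv (by simp) hΩo hx hsm
      L.toContinuousLinearEquiv ?_
    ext u
    rfl
  rw [isOpen_iff_mem_nhds]
  rintro _ ⟨x, hxV, rfl⟩
  rw [← hloc.isLocalHomeomorphOn.map_nhds_eq (hVΩ hxV)]
  exact Filter.image_mem_map (hV.mem_nhds hxV)

/-- The far parts `Φ(Σ × (0,t))` are open. [folklore] -/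
theorem isOpen_image_far
    (hsm : ContMDiffOn ((𝓡 4).prod 𝓘(ℝ, ℝ)) (𝓡 5) ∞ Φ (univ ×ˢ Ioo (0 : ℝ) 1))
    (himm : ∀ p ∈ univ ×ˢ Ioo (0 : ℝ) 1,
      Function.Injective (mfderiv ((𝓡 4).prod 𝓘(ℝ, ℝ)) (𝓡 5) Φ p))
    {t : ℝ} (ht : t ∈ Ioo (0 : ℝ) 1) : IsOpen (Φ '' (univ ×ˢ Ioo (0 : ℝ) t)) :=
  isOpen_image_collar S Φ hsm himm (isOpen_univ.prod isOpen_Ioo)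
    (prod_mono Subset.rfl (Ioo_subset_Ioo_right ht.2.le))

/-- **Closure of a far part inside the collar**: `cl Φ(Σ × (0,t)) = Φ(Σ × (0,t])` (the closure
clause `hcl` of the crux puts the closure inside the collar, where `Φ` is an injective open map).
[folklore] -/
theorem closure_image_far
    (hsm : ContMDiffOn ((𝓡 4).prod 𝓘(ℝ, ℝ)) (𝓡 5) ∞ Φ (univ ×ˢ Ioo (0 : ℝ) 1))
    (hinj : InjOn Φ (univ ×ˢ Ioo (0 : ℝ) 1))
    (himm : ∀ p ∈ univ ×ˢ Ioo (0 : ℝ) 1,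
      Function.Injective (mfderiv ((𝓡 4).prod 𝓘(ℝ, ℝ)) (𝓡 5) Φ p))
    (hcl : ∀ t ∈ Ioo (0 : ℝ) 1,
      closure (Φ '' (univ ×ˢ Ioo (0 : ℝ) t)) ⊆ Φ '' (univ ×ˢ Ioo (0 : ℝ) 1))
    {t : ℝ} (ht : t ∈ Ioo (0 : ℝ) 1) :
    closure (Φ '' (univ ×ˢ Ioo (0 : ℝ) t)) = Φ '' (univ ×ˢ Ioc (0 : ℝ) t) := by
  have hΩo : IsOpen (univ ×ˢ Ioo (0 : ℝ) 1 : Set (S.carrier × ℝ)) := isOpen_univ.prod isOpen_Ioo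
  apply Subset.antisymm
  · intro y hy
    obtain ⟨x, hxΩ, rfl⟩ := hcl t ht hy
    by_contra hne
    have hxt : t < x.2 := by
      by_contra h
      exact hne ⟨x, ⟨mem_univ _, hxΩ.2.1, not_lt.1 h⟩, rfl⟩
    have hO : IsOpen (Φ '' (univ ×ˢ Ioo t 1)) :=
      isOpen_image_collar S Φ hsm himm (isOpen_univ.prod isOpen_Ioo)
        (prod_mono Subset.rfl (Ioo_subset_Ioo_left ht.1.le))
    have hmem : Φ x ∈ Φ '' (univ ×ˢ Ioo t 1) := ⟨x, ⟨mem_univ _, hxt, hxΩ.2.2⟩, rfl⟩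
    rw [mem_closure_iff] at hy
    obtain ⟨z, ⟨x'', hx'', rfl⟩, ⟨x', hx', hzx'⟩⟩ := hy _ hO hmem
    have heq : x' = x'' :=
      hinj ⟨mem_univ _, hx'.2.1, hx'.2.2.trans ht.2⟩ ⟨mem_univ _, ht.1.trans hx''.2.1, hx''.2.2⟩
        hzx'
    have h1 : x'.2 < t := hx'.2.2
    have h2 : t < x''.2 := hx''.2.1
    rw [heq] at h1
    exact lt_irrefl _ (h2.trans h1)
  · rintro _ ⟨x, hx, rfl⟩
    have hxΩ : x ∈ (univ ×ˢ Ioo (0 : ℝ) 1 : Set (S.carrier × ℝ)) :=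
      ⟨mem_univ _, hx.2.1, lt_of_le_of_lt hx.2.2 ht.2⟩
    have hxcl : x ∈ closure (univ ×ˢ Ioo (0 : ℝ) t : Set (S.carrier × ℝ)) := by
      rw [closure_prod_eq, closure_univ, closure_Ioo ht.1.ne]
      exact ⟨mem_univ _, hx.2.1.le, hx.2.2⟩
    have hcont : ContinuousWithinAt Φ (univ ×ˢ Ioo (0 : ℝ) t) x :=
      (hsm.continuousOn.continuousAt (hΩo.mem_nhds hxΩ)).continuousWithinAt
    exact hcont.mem_closure_image hxcl

/-- **The frontier of a far complement is the slice**: `∂ K_t = Φ(Σ × {t})` for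
`K_t = (Φ(Σ × (0,t)))ᶜ`. [folklore] -/
theorem frontier_far_compl
    (hsm : ContMDiffOn ((𝓡 4).prod 𝓘(ℝ, ℝ)) (𝓡 5) ∞ Φ (univ ×ˢ Ioo (0 : ℝ) 1))
    (hinj : InjOn Φ (univ ×ˢ Ioo (0 : ℝ) 1))
    (himm : ∀ p ∈ univ ×ˢ Ioo (0 : ℝ) 1,
      Function.Injective (mfderiv ((𝓡 4).prod 𝓘(ℝ, ℝ)) (𝓡 5) Φ p))
    (hcl : ∀ t ∈ Ioo (0 : ℝ) 1,
      closure (Φ '' (univ ×ˢ Ioo (0 : ℝ) t)) ⊆ Φ '' (univ ×ˢ Ioo (0 : ℝ) 1))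
    {t : ℝ} (ht : t ∈ Ioo (0 : ℝ) 1) :
    frontier (Φ '' (univ ×ˢ Ioo (0 : ℝ) t))ᶜ = Φ '' (univ ×ˢ {t}) := by
  rw [frontier_compl, frontier, closure_image_far S Φ hsm hinj himm hcl ht,
    (isOpen_image_far S Φ hsm himm ht).interior_eq]
  ext y
  constructor
  · rintro ⟨⟨x, hx, rfl⟩, hnot⟩
    refine ⟨x, ⟨mem_univ _, ?_⟩, rfl⟩
    rcases hx.2.2.lt_or_eq with hlt | heq
    · exact absurd ⟨x, ⟨mem_univ _, hx.2.1, hlt⟩, rfl⟩ hnot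
    · exact heq
  · rintro ⟨x, hx, rfl⟩
    have hx2 : x.2 = t := hx.2
    refine ⟨⟨x, ⟨mem_univ _, by rw [hx2]; exact ht.1, by rw [hx2]⟩, rfl⟩, ?_⟩
    rintro ⟨x', hx', heq⟩
    have hxΩ : x ∈ (univ ×ˢ Ioo (0 : ℝ) 1 : Set (S.carrier × ℝ)) :=
      ⟨mem_univ _, by rw [hx2]; exact ht.1, by rw [hx2]; exact ht.2⟩
    have := hinj ⟨mem_univ _, hx'.2.1, hx'.2.2.trans ht.2⟩ hxΩ heq
    have h1 : x'.2 < t := hx'.2.2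
    rw [this, hx2] at h1
    exact lt_irrefl _ h1

/-- **The inverse of the collar map is continuous on the collar** (`Φ` is an injective open map
on `Σ × (0,1)`). [folklore] -/
theorem continuousOn_invFunOn_collar [Nonempty S.carrier]
    (hsm : ContMDiffOn ((𝓡 4).prod 𝓘(ℝ, ℝ)) (𝓡 5) ∞ Φ (univ ×ˢ Ioo (0 : ℝ) 1))
    (hinj : InjOn Φ (univ ×ˢ Ioo (0 : ℝ) 1))
    (himm : ∀ p ∈ univ ×ˢ Ioo (0 : ℝ) 1,
      Function.Injective (mfderiv ((𝓡 4).prod 𝓘(ℝ, ℝ)) (𝓡 5) Φ p)) :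
    ContinuousOn (invFunOn Φ (univ ×ˢ Ioo (0 : ℝ) 1)) (Φ '' (univ ×ˢ Ioo (0 : ℝ) 1)) := by
  have hΩo : IsOpen (univ ×ˢ Ioo (0 : ℝ) 1 : Set (S.carrier × ℝ)) := isOpen_univ.prod isOpen_Ioo
  have hleft : ∀ x ∈ (univ ×ˢ Ioo (0 : ℝ) 1 : Set (S.carrier × ℝ)),
      invFunOn Φ (univ ×ˢ Ioo (0 : ℝ) 1) (Φ x) = x := fun x hx ↦ hinj.leftInvOn_invFunOn hx
  rw [continuousOn_iff']
  intro V hV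
  refine ⟨Φ '' (V ∩ univ ×ˢ Ioo (0 : ℝ) 1),
    isOpen_image_collar S Φ hsm himm (hV.inter hΩo) inter_subset_right, ?_⟩
  ext y
  constructor
  · rintro ⟨hyV, ⟨x, hx, rfl⟩⟩
    have hxV : x ∈ V := by
      have h := hyV
      rw [mem_preimage, hleft x hx] at h
      exact h
    exact ⟨⟨x, ⟨hxV, hx⟩, rfl⟩, ⟨x, hx, rfl⟩⟩
  · rintro ⟨⟨x, ⟨hxV, hxΩ⟩, rfl⟩, -⟩
    refine ⟨?_, ⟨x, hxΩ, rfl⟩⟩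
    rw [mem_preimage, hleft x hxΩ]
    exact hxV

/-- **The vertical retraction of the collar**: `W` deformation retracts onto the far complement
`K_t = (Φ(Σ × (0,t)))ᶜ`, by `H(s, Φ(σ, λ)) = Φ(σ, λ + s (t - λ))` for `λ ≤ t` and `H(s, ·) = id`
on `K_t` (the two formulas agree on the slice `Φ(Σ × {t})`, and are continuous on the closed
sets `[0,1] × Φ(Σ × (0,t])` and `[0,1] × K_t` covering `[0,1] × W`). [folklore] -/
theorem exists_retraction_far_compl [Nonempty S.carrier]
    (hsm : ContMDiffOn ((𝓡 4).prod 𝓘(ℝ, ℝ)) (𝓡 5) ∞ Φ (univ ×ˢ Ioo (0 : ℝ) 1))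
    (hinj : InjOn Φ (univ ×ˢ Ioo (0 : ℝ) 1))
    (himm : ∀ p ∈ univ ×ˢ Ioo (0 : ℝ) 1,
      Function.Injective (mfderiv ((𝓡 4).prod 𝓘(ℝ, ℝ)) (𝓡 5) Φ p))
    (hcl : ∀ t ∈ Ioo (0 : ℝ) 1,
      closure (Φ '' (univ ×ˢ Ioo (0 : ℝ) t)) ⊆ Φ '' (univ ×ˢ Ioo (0 : ℝ) 1))
    {t : ℝ} (ht : t ∈ Ioo (0 : ℝ) 1) :
    ∃ H : C(unitInterval × W, W), (∀ y, H (0, y) = y) ∧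
      (∀ y, H (1, y) ∈ (Φ '' (univ ×ˢ Ioo (0 : ℝ) t))ᶜ) ∧
      (∀ (s : unitInterval), ∀ a ∈ (Φ '' (univ ×ˢ Ioo (0 : ℝ) t))ᶜ, H (s, a) = a) := by
  classical
  have hΩo : IsOpen (univ ×ˢ Ioo (0 : ℝ) 1 : Set (S.carrier × ℝ)) := isOpen_univ.prod isOpen_Ioo
  set Ω : Set (S.carrier × ℝ) := univ ×ˢ Ioo (0 : ℝ) 1 with hΩ
  set ψ : W → S.carrier × ℝ := invFunOn Φ Ω with hψ
  have hleft : ∀ x ∈ Ω, ψ (Φ x) = x := fun x hx ↦ hinj.leftInvOn_invFunOn hx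
  set Z : Set W := Φ '' (univ ×ˢ Ioc (0 : ℝ) t) with hZ
  set K : Set W := (Φ '' (univ ×ˢ Ioo (0 : ℝ) t))ᶜ with hK
  have hZcl : IsClosed Z := by
    rw [hZ, ← closure_image_far S Φ hsm hinj himm hcl ht]
    exact isClosed_closure
  have hKcl : IsClosed K := (isOpen_image_far S Φ hsm himm ht).isClosed_compl
  have hZΩ : ∀ x : S.carrier × ℝ, x ∈ (univ ×ˢ Ioc (0 : ℝ) t : Set (S.carrier × ℝ)) → x ∈ Ω :=
    fun x hx ↦ ⟨mem_univ _, hx.2.1, lt_of_le_of_lt hx.2.2 ht.2⟩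
  have hZU : Z ⊆ Φ '' Ω := by
    rintro _ ⟨x, hx, rfl⟩
    exact ⟨x, hZΩ x hx, rfl⟩
  -- a point of `Z ∩ K` lies on the slice: its height is `t`
  have hZK : ∀ x : S.carrier × ℝ, x ∈ (univ ×ˢ Ioc (0 : ℝ) t : Set (S.carrier × ℝ)) →
      Φ x ∈ K → x.2 = t := by
    intro x hx hxK
    rcases hx.2.2.lt_or_eq with hlt | heq
    · exact absurd ⟨x, ⟨mem_univ _, hx.2.1, hlt⟩, rfl⟩ hxK
    · exact heq
  -- the moved point `g (s, y) = (σ(y), λ(y) + s (t - λ(y)))` and the formula `A = Φ ∘ g`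
  set g : unitInterval × W → S.carrier × ℝ :=
    fun q ↦ ((ψ q.2).1, (ψ q.2).2 + (q.1 : ℝ) * (t - (ψ q.2).2)) with hg
  have hgΩ : ∀ (s : unitInterval) (y : W), y ∈ Z → g (s, y) ∈ Ω := by
    rintro s y ⟨x, hx, rfl⟩
    simp only [hg, hleft x (hZΩ x hx)]
    have hs0 : (0 : ℝ) ≤ s := s.2.1
    have hs1 : (s : ℝ) ≤ 1 := s.2.2
    refine ⟨mem_univ _, ?_, ?_⟩
    · nlinarith [hx.2.1, hx.2.2]
    · nlinarith [hx.2.1, hx.2.2, ht.2]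
  have hψc : ContinuousOn ψ (Φ '' Ω) := continuousOn_invFunOn_collar S Φ hsm hinj himm
  have hgc : ContinuousOn g (univ ×ˢ Z) := by
    have hψ2 : ContinuousOn (fun q : unitInterval × W ↦ ψ q.2) (univ ×ˢ Z) :=
      hψc.comp continuousOn_snd fun q hq ↦ hZU hq.2
    have h1 : ContinuousOn (fun q : unitInterval × W ↦ (ψ q.2).1) (univ ×ˢ Z) :=
      continuous_fst.comp_continuousOn hψ2
    have h2 : ContinuousOn (fun q : unitInterval × W ↦ (ψ q.2).2) (univ ×ˢ Z) :=
      continuous_snd.comp_continuousOn hψ2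
    have h3 : ContinuousOn (fun q : unitInterval × W ↦ ((q.1 : ℝ))) (univ ×ˢ Z) :=
      (continuous_subtype_val.comp continuous_fst).continuousOn
    exact h1.prodMk (h2.add (h3.mul (continuousOn_const.sub h2)))
  have hAc : ContinuousOn (fun q : unitInterval × W ↦ Φ (g q)) (univ ×ˢ Z) :=
    hsm.continuousOn.comp hgc fun q hq ↦ hgΩ q.1 q.2 hq.2
  -- the homotopy
  set f : unitInterval × W → W := fun q ↦ if q.2 ∈ Z then Φ (g q) else q.2 with hf
  have hfZ : ∀ q : unitInterval × W, q.2 ∈ Z → f q = Φ (g q) := fun q hq ↦ if_pos hq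
  have hfK : ∀ q : unitInterval × W, q.2 ∈ K → f q = q.2 := by
    rintro ⟨s, y⟩ hyK
    by_cases hyZ : y ∈ Z
    · rw [hfZ _ hyZ]
      obtain ⟨x, hx, rfl⟩ := hyZ
      have hx2 : x.2 = t := hZK x hx hyK
      simp only [hg, hleft x (hZΩ x hx), hx2, sub_self, mul_zero, add_zero]
      rw [← hx2]
    · exact if_neg hyZ
  have hfc : Continuous f := by
    rw [← continuousOn_univ]
    have hcover : (univ : Set (unitInterval × W)) = univ ×ˢ Z ∪ univ ×ˢ K := by
      ext ⟨s, y⟩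
      simp only [mem_univ, true_iff, mem_union, mem_prod, true_and]
      by_cases hy : y ∈ Φ '' (univ ×ˢ Ioo (0 : ℝ) t)
      · left
        obtain ⟨x, hx, rfl⟩ := hy
        exact ⟨x, ⟨mem_univ _, hx.2.1, hx.2.2.le⟩, rfl⟩
      · right
        exact hy
    rw [hcover]
    refine ContinuousOn.union_of_isClosed ?_ ?_ (isClosed_univ.prod hZcl)
      (isClosed_univ.prod hKcl)
    · exact hAc.congr fun q hq ↦ hfZ q hq.2
    · exact continuousOn_snd.congr fun q hq ↦ hfK q hq.2
  refine ⟨⟨f, hfc⟩, fun y ↦ ?_, fun y ↦ ?_, fun s a ha ↦ hfK (s, a) ha⟩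
  · -- `H(0, y) = y`
    show f (0, y) = y
    by_cases hyZ : y ∈ Z
    · rw [hfZ _ hyZ]
      obtain ⟨x, hx, rfl⟩ := hyZ
      simp only [hg, hleft x (hZΩ x hx)]
      simp
    · exact if_neg hyZ
  · -- `H(1, y) ∈ K`
    show f (1, y) ∈ K
    by_cases hyZ : y ∈ Z
    · rw [hfZ _ hyZ]
      obtain ⟨x, hx, rfl⟩ := hyZ
      simp only [hg, hleft x (hZΩ x hx)]
      rintro ⟨x', hx', heq⟩
      have h1 : ((1 : unitInterval) : ℝ) = 1 := rfl
      rw [h1, one_mul, add_sub_cancel] at heq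
      have hmem : ((x.1, t) : S.carrier × ℝ) ∈ Ω := ⟨mem_univ _, ht.1, ht.2⟩
      have := hinj ⟨mem_univ _, hx'.2.1, hx'.2.2.trans ht.2⟩ hmem heq
      have h2 : x'.2 < t := hx'.2.2
      rw [this] at h2
      exact lt_irrefl _ h2
    · have hfy : f (1, y) = y := if_neg hyZ
      rw [hfy]
      intro hy
      apply hyZ
      obtain ⟨x, hx, rfl⟩ := hy
      exact ⟨x, ⟨mem_univ _, hx.2.1, hx.2.2.le⟩, rfl⟩

omit [IsManifold (𝓡 5) ∞ W] in
/-- **The slice embedding `σ ↦ Φ(σ, t)`**: smooth, with injective differential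
(`d(σ ↦ (σ, t))` is a section of `d pr₁`, and `dΦ` is injective on the collar). [folklore] -/
theorem slice_contMDiff_injective_mfderiv
    (hsm : ContMDiffOn ((𝓡 4).prod 𝓘(ℝ, ℝ)) (𝓡 5) ∞ Φ (univ ×ˢ Ioo (0 : ℝ) 1))
    (himm : ∀ p ∈ univ ×ˢ Ioo (0 : ℝ) 1,
      Function.Injective (mfderiv ((𝓡 4).prod 𝓘(ℝ, ℝ)) (𝓡 5) Φ p))
    {t : ℝ} (ht : t ∈ Ioo (0 : ℝ) 1) :
    ContMDiff (𝓡 4) (𝓡 5) ∞ (fun σ : S.carrier ↦ Φ (σ, t)) ∧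
      ∀ σ : S.carrier, Injective (mfderiv (𝓡 4) (𝓡 5) (fun σ : S.carrier ↦ Φ (σ, t)) σ) := by
  have hΩo : IsOpen (univ ×ˢ Ioo (0 : ℝ) 1 : Set (S.carrier × ℝ)) := isOpen_univ.prod isOpen_Ioo
  set incl : S.carrier → S.carrier × ℝ := fun σ ↦ (σ, t) with hincl
  have hincl : ContMDiff (𝓡 4) ((𝓡 4).prod 𝓘(ℝ, ℝ)) ∞ incl := contMDiff_id.prodMk contMDiff_const
  have hmem : ∀ σ, incl σ ∈ (univ ×ˢ Ioo (0 : ℝ) 1 : Set (S.carrier × ℝ)) :=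
    fun σ ↦ ⟨mem_univ _, ht⟩
  have hι : ContMDiff (𝓡 4) (𝓡 5) ∞ (fun σ : S.carrier ↦ Φ (σ, t)) :=
    hsm.comp_contMDiff hincl hmem
  refine ⟨hι, fun σ ↦ ?_⟩
  have hΦd : MDifferentiableAt ((𝓡 4).prod 𝓘(ℝ, ℝ)) (𝓡 5) Φ (incl σ) :=
    (hsm.contMDiffAt (hΩo.mem_nhds (hmem σ))).mdifferentiableAt (by simp)
  have hid : MDifferentiableAt (𝓡 4) ((𝓡 4).prod 𝓘(ℝ, ℝ)) incl σ :=
    (hincl σ).mdifferentiableAt (by simp)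
  have hchain : mfderiv (𝓡 4) (𝓡 5) (fun σ : S.carrier ↦ Φ (σ, t)) σ =
      (mfderiv ((𝓡 4).prod 𝓘(ℝ, ℝ)) (𝓡 5) Φ (incl σ)).comp
        (mfderiv (𝓡 4) ((𝓡 4).prod 𝓘(ℝ, ℝ)) incl σ) :=
    mfderiv_comp σ hΦd hid
  -- `d(pr₁) ∘ d(incl) = id`
  have hsec : ∀ v, mfderiv ((𝓡 4).prod 𝓘(ℝ, ℝ)) (𝓡 4) Prod.fst (incl σ)
      (mfderiv (𝓡 4) ((𝓡 4).prod 𝓘(ℝ, ℝ)) incl σ v) = v := by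
    intro v
    have h1 : mfderiv (𝓡 4) (𝓡 4) (Prod.fst ∘ incl) σ =
        (mfderiv ((𝓡 4).prod 𝓘(ℝ, ℝ)) (𝓡 4) Prod.fst (incl σ)).comp
          (mfderiv (𝓡 4) ((𝓡 4).prod 𝓘(ℝ, ℝ)) incl σ) :=
      mfderiv_comp σ mdifferentiableAt_fst hid
    have h2 : mfderiv (𝓡 4) (𝓡 4) (Prod.fst ∘ incl) σ = ContinuousLinearMap.id ℝ _ := by
      have : (Prod.fst ∘ incl) = @id S.carrier := rfl
      rw [this]
      exact mfderiv_id
    have h3 := congrArg (fun L ↦ L v) (h1.symm.trans h2)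
    exact h3
  intro v w hvw
  have key : ∀ u, mfderiv (𝓡 4) (𝓡 5) (fun σ : S.carrier ↦ Φ (σ, t)) σ u =
      mfderiv ((𝓡 4).prod 𝓘(ℝ, ℝ)) (𝓡 5) Φ (incl σ)
        (mfderiv (𝓡 4) ((𝓡 4).prod 𝓘(ℝ, ℝ)) incl σ u) := fun u ↦ by
    rw [hchain]
    rfl
  rw [key, key] at hvw
  have h := himm (incl σ) (hmem σ) hvw
  rw [← hsec v, ← hsec w, h]


/-- **The registered stub `stub_collarPackage`** (collar bookkeeping of the crux's end collar): for
a homotopy 4-sphere `S`, a map `Φ : S × ℝ → W⁵` smooth, injective and immersive on `S × (0,1)` with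
the closure clause, and `t ∈ (0,1)`: `S` is nonempty and simply connected, the far part
`Φ(S × (0,t))` is open, `∂K_t = Φ(S × {t})`, `W` deformation retracts vertically onto `K_t`, and
`σ ↦ Φ(σ, t)` is a smooth immersion. [folklore] -/
theorem stub_collarPackage
    (S : HomotopySphere 4) (W : Type) [TopologicalSpace W] [T2Space W] [SecondCountableTopology W]
    [ChartedSpace E5 W] [IsManifold (𝓡 5) ∞ W]
    (Φ : S.carrier × ℝ → W)
    (hsm : ContMDiffOn ((𝓡 4).prod 𝓘(ℝ, ℝ)) (𝓡 5) ∞ Φ (univ ×ˢ Ioo (0 : ℝ) 1))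
    (hinj : InjOn Φ (univ ×ˢ Ioo (0 : ℝ) 1))
    (himm : ∀ p ∈ univ ×ˢ Ioo (0 : ℝ) 1,
      Function.Injective (mfderiv ((𝓡 4).prod 𝓘(ℝ, ℝ)) (𝓡 5) Φ p))
    (hcl : ∀ t ∈ Ioo (0 : ℝ) 1, closure (Φ '' (univ ×ˢ Ioo (0 : ℝ) t)) ⊆ Φ '' (univ ×ˢ Ioo (0 : ℝ) 1))
    (t : ℝ) (ht : t ∈ Ioo (0 : ℝ) 1) :
    Nonempty S.carrier ∧ SimplyConnectedSpace S.carrier ∧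
    IsOpen (Φ '' (univ ×ˢ Ioo (0 : ℝ) t)) ∧
    frontier (Φ '' (univ ×ˢ Ioo (0 : ℝ) t))ᶜ = Φ '' (univ ×ˢ {t}) ∧
    (∃ H : C(unitInterval × W, W), (∀ y, H (0, y) = y) ∧
      (∀ y, H (1, y) ∈ (Φ '' (univ ×ˢ Ioo (0 : ℝ) t))ᶜ) ∧
      (∀ (s : unitInterval), ∀ a ∈ (Φ '' (univ ×ˢ Ioo (0 : ℝ) t))ᶜ, H (s, a) = a)) ∧
    ContMDiff (𝓡 4) (𝓡 5) ∞ (fun σ : S.carrier ↦ Φ (σ, t)) ∧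
    (∀ σ : S.carrier, Injective (mfderiv (𝓡 4) (𝓡 5) (fun σ : S.carrier ↦ Φ (σ, t)) σ)) := by
  haveI : Nonempty S.carrier := nonempty_carrier S
  obtain ⟨hιs, hιimm⟩ := slice_contMDiff_injective_mfderiv S Φ hsm himm ht
  exact ⟨inferInstance, simplyConnectedSpace_carrier S, isOpen_image_far S Φ hsm himm ht,
    frontier_far_compl S Φ hsm hinj himm hcl ht,
    exists_retraction_far_compl S Φ hsm hinj himm hcl ht, hιs, hιimm⟩

end Summit.SmoothPoincare4.SmoothPoincare4.Cruxes.AhHadamardFilling.Sketch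

end
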